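import Literature.NumberTheory.EllipticCurves.FormalGroupTranslationTaylorProofs
import Mathlib.Analysis.Analytic.Polynomial
import Mathlib.Analysis.Calculus.Deriv.CompMul
import HarnessLib

/-!
# The CM transformation identity `℘(αz) = R(℘(z))` read on the formal group: `x(P₁^α + P([α] t)) = R(x(P₁ + P(t)))`
# as an identity of `t`-expansions (Silverman AT II.1.1/II.2, de Shalit II.1.10, II.4.9 — proofs only)

Topic `NumberTheory/EllipticCurves` (theorems only; no definition, no named fact, no instance).  Sequel of
`FormalGroupTranslationTaylorProofs` (`taylor_weierstrassP_add_sub_eq_translateX_subst_formalExp`: for `Ω ∉ Λ` the Taylor series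
at `0` of `v ↦ ℘(Ω + v) − b₂/12` IS `translateX(ξ(Ω)) ∘ exp_W`).  Input: a period pair `L` with the invariants of `W/ℂ`
(`g₂ = c₄/12`, `g₃ = c₆/216`), a multiplier `α` and a rational map `(P, Q)` with **`℘(αz) = P(℘ z)/Q(℘ z)`** off the poles (the
output of the tree's `PeriodPair.exists_rationalMap_of_mul_mem`, Cox Thm. 10.14, or of a kernel-checked CM certificate
`CMCert.IsCMCertificate` — e.g. `d = −7`, degree `2`).  Output, for `Ω` with `Ω, αΩ ∉ Λ` (`P₁ = ξ(Ω)`, `P₁^α := ξ(αΩ)`, `b = b₂/12`,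
`x = ℘ − b`):

* §1 Taylor calculus: `iteratedDeriv_comp_const_mul'` (unconditional `(f(c·))⁽ⁿ⁾ = cⁿ f⁽ⁿ⁾(c·)`), `taylor_comp_const_mul`
  (`𝓣[v ↦ f(cv)] = rescale c 𝓣[f]`), `taylor_aeval` (`𝓣[p(g)] = p(𝓣[g])` for a polynomial `p`);
* §2 ★★ `rescale_translateX_subst_formalExp_mul_aeval_eq` — in the LOGARITHMIC coordinate:
  **`(rescale α (translateX(ξ(αΩ)) ∘ exp_W) + C b) · Q(translateX(ξ Ω) ∘ exp_W + C b) = P(translateX(ξ Ω) ∘ exp_W + C b)`**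
  (the Taylor series of `v ↦ ℘(α(Ω + v))` computed once through `ξ(αΩ + αv)` and once through `R(℘(Ω + v))`);
* §3 ★★★ `translateX_subst_formalMulBy_add_C_mul_aeval_eq` — in the FORMAL-GROUP coordinate `t` (cancel `exp_W`):
  **`((translateX(ξ(αΩ))) ∘ [α]_Ê + C b) · Q(translateX(ξ Ω) + C b) = P(translateX(ξ Ω) + C b)`** with
  `[α]_Ê := exp_W ∘ (α · log_W)` (`W.formalExp.subst (C α * W.formalLog)`, the tree's CM endomorphism of the formal group,
  `FormalGroupPadicIntEndomorphisms`, `OrdinaryFormalGroupLubinTate`) — i.e. **`x(ξ(αΩ) ⊕ P([α]_Ê t)) = R(x(ξ(Ω) ⊕ P(t)))` as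
  `t`-series**: the `x`-coordinate of the algebraic multiplication `[α]` (chart `x ↦ R(x + b) − b`) agrees with the formal `[α]_Ê` on
  the translate of the formal group through `P₁`.  This is the formal half of de Shalit II.1.10 («`Ê` with `[ψ(𝔭)]` is a Lubin–Tate
  group») / of ingredient (CM-POINTS)(ii) of the cell's CM bridge (memo `Cruxes/TwoVariableMainConjAtSplitTwoQuad/PRINT-DRAFT-II15-w4g14.md` §3);
  descent to `K` and evaluation at `𝔪`-points (`FormalGroupNilIdealPointsTranslate.some_add_ptOfZ`) are left to the sequel.

Cell `bsd-print-cf2`, width seat `bsd-line-cf2c-w4` g14; no summit statement is proved; BSD is not proved by any of this.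

## References
* [SilvermanATAEC1994] J. H. Silverman, *Advanced Topics in the Arithmetic of Elliptic Curves* (1994), II Prop. 1.1, §II.2 (`[α]^*ω = αω`).
* [deShalit1987] E. de Shalit, *Iwasawa theory of elliptic curves with complex multiplication* (1987), II §1.3, §1.10, §4.9.
* [Cox2013] D. A. Cox, *Primes of the form x² + ny²*, 2nd ed. (2013), Thm. 10.14, Prop. 14.9 (`℘(wz) = (P/Q)(℘ z)`).
* [SilvermanAEC2009] J. H. Silverman, *The Arithmetic of Elliptic Curves*, 2nd ed. (2009), IV.1, VI.3.6.
-/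

noncomputable section

open PowerSeries Filter Set Literature.NumberTheory.Transcendental.AndreCriterion
open scoped Topology Nat Classical

/-- The Taylor series of `f : ℂ → ℂ` at `0` (local notation, as in `AndreCriterionAnalyticProofs`). -/
local notation3 "𝓣[" f "]" =>
  (PowerSeries.mk fun n => ((Nat.factorial n : ℂ)⁻¹ * iteratedDeriv n f 0) : PowerSeries ℂ)

namespace Literature.NumberTheory.EllipticCurves

/-! ## §1 Taylor calculus: rescaling the argument, polynomials of an analytic germ -/

section Taylor

/-- `(v ↦ f(cv))⁽ⁿ⁾ = v ↦ cⁿ·f⁽ⁿ⁾(cv)`, unconditionally (Mathlib's `deriv_comp_mul_left` needs no differentiability).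
[cite: SilvermanAEC2009, IV.1] -/
theorem iteratedDeriv_comp_const_mul' (f : ℂ → ℂ) (c : ℂ) (n : ℕ) :
    iteratedDeriv n (fun w => f (c * w)) = fun v => c ^ n * iteratedDeriv n f (c * v) := by
  induction n with
  | zero => funext v; simp
  | succ n ih =>
    funext v
    rw [iteratedDeriv_succ, ih, deriv_const_mul_field, iteratedDeriv_succ]
    have h := deriv_comp_mul_left (f := iteratedDeriv n f) (c := c) (x := v)
    rw [smul_eq_mul] at h
    rw [h, pow_succ]
    ring

/-- **`𝓣[v ↦ f(cv)] = rescale c 𝓣[f]`.** [cite: SilvermanAEC2009, IV.1] -/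
theorem taylor_comp_const_mul (f : ℂ → ℂ) (c : ℂ) : 𝓣[fun w => f (c * w)] = rescale c 𝓣[f] := by
  ext n
  rw [coeff_taylor, coeff_rescale, coeff_taylor, iteratedDeriv_comp_const_mul']
  simp only [mul_zero]
  ring

/-- `v ↦ p(g v)` is analytic at `0` for a polynomial `p` and an analytic germ `g`. [cite: SilvermanAEC2009, IV.1] -/
theorem analyticAt_eval_comp {g : ℂ → ℂ} (hg : AnalyticAt ℂ g 0) (p : Polynomial ℂ) :
    AnalyticAt ℂ (fun v => p.eval (g v)) 0 := by
  have h := hg.aeval_polynomial p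
  simpa only [Polynomial.coe_aeval_eq_eval] using h

/-- **`𝓣[v ↦ p(g v)] = p(𝓣[g])`** for a polynomial `p` and an analytic germ `g`. [cite: SilvermanAEC2009, IV.1] -/
theorem taylor_eval_comp {g : ℂ → ℂ} (hg : AnalyticAt ℂ g 0) (p : Polynomial ℂ) :
    𝓣[fun v => p.eval (g v)] = Polynomial.aeval 𝓣[g] p := by
  induction p using Polynomial.induction_on' with
  | add p q hp hq =>
    have e : (fun v => (p + q).eval (g v)) = (fun v => p.eval (g v)) + fun v => q.eval (g v) := by
      funext v; simp only [Polynomial.eval_add, Pi.add_apply]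
    rw [e, taylor_add (analyticAt_eval_comp hg p) (analyticAt_eval_comp hg q), hp, hq, map_add]
  | monomial n a =>
    have e : (fun v => (Polynomial.monomial n a).eval (g v)) = fun v => a * (g ^ n) v := by
      funext v; simp only [Polynomial.eval_monomial, Pi.pow_apply]
    rw [e, taylor_const_mul, taylor_pow hg, Polynomial.aeval_monomial, C_eq_algebraMap]

end Taylor

end Literature.NumberTheory.EllipticCurves

namespace WeierstrassCurve

open PeriodPair Literature.NumberTheory.EllipticCurves

variable (L : PeriodPair) (W : WeierstrassCurve ℂ)

/-! ## §2 The transformation identity in the logarithmic coordinate -/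

/-- `α(Ω + v) ∉ Λ` near `v = 0` when `αΩ ∉ Λ`. [cite: SilvermanAEC2009, VI.3.6] -/
theorem eventually_mul_add_notMem_lattice {α Ω : ℂ} (hαΩ : α * Ω ∉ L.lattice) :
    ∀ᶠ v in 𝓝 (0 : ℂ), α * (Ω + v) ∉ L.lattice := by
  have hopen : IsOpen ((L.lattice : Set ℂ)ᶜ) := L.isClosed_lattice.isOpen_compl
  have hcont : Continuous fun v : ℂ => α * (Ω + v) := continuous_const.mul (continuous_const.add continuous_id)
  have : (fun v : ℂ => α * (Ω + v)) ⁻¹' (L.lattice : Set ℂ)ᶜ ∈ 𝓝 (0 : ℂ) :=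
    hcont.continuousAt.preimage_mem_nhds (hopen.mem_nhds (by simpa using hαΩ))
  filter_upwards [this] with v hv
  exact hv

/-- `v ↦ ℘(Ω + v)` is analytic at `0` for `Ω ∉ Λ`. [cite: SilvermanAEC2009, VI.3.1] -/
theorem analyticAt_weierstrassP_const_add {Ω : ℂ} (hΩ : Ω ∉ L.lattice) : AnalyticAt ℂ (fun v : ℂ => ℘[L] (Ω + v)) 0 :=
  (L.analyticOnNhd_weierstrassP (Ω + 0) (by simpa using hΩ)).comp (analyticAt_const.add analyticAt_id)

/-- ★★ **The CM transformation identity in the logarithmic coordinate.**  Let `℘(αz) = P(℘ z)/Q(℘ z)` off the poles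
(`hR`), and `Ω, αΩ ∉ Λ`; put `x = ℘ − b`, `b = b₂/12`, `T := translateX(ξ Ω) ∘ exp_W = 𝓣[v ↦ x(Ω + v)]`,
`T₁ := translateX(ξ(αΩ)) ∘ exp_W`.  Then **`(rescale α T₁ + C b) · Q(T + C b) = P(T + C b)`** in `ℂ⟦z⟧`: both sides are the Taylor
series of `v ↦ ℘(α(Ω + v))·Q(℘(Ω + v))` — the left because `℘(αΩ + αv) − b` has Taylor series `rescale α 𝓣[u ↦ x(αΩ + u)]`.
[cite: Cox2013, Prop. 14.9] [cite: SilvermanATAEC1994, II Prop. 1.1] [cite: deShalit1987, II §4.9] -/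
theorem rescale_translateX_subst_formalExp_mul_aeval_eq (h₂ : L.g₂ = W.c₄ / 12) (h₃ : L.g₃ = W.c₆ / 216) {α : ℂ}
    {P Q : Polynomial ℂ}
    (hR : ∀ z : ℂ, α * z ∉ L.lattice → Q.eval (℘[L] z) ≠ 0 ∧ ℘[L] (α * z) = P.eval (℘[L] z) / Q.eval (℘[L] z))
    {Ω : ℂ} (hΩ : Ω ∉ L.lattice) (hαΩ : α * Ω ∉ L.lattice) :
    (rescale α ((W.translateX (℘[L] (α * Ω) - W.b₂ / 12)
        ((℘'[L] (α * Ω) - W.a₁ * (℘[L] (α * Ω) - W.b₂ / 12) - W.a₃) / 2)).subst W.formalExp) + C (W.b₂ / 12)) *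
      Polynomial.aeval ((W.translateX (℘[L] Ω - W.b₂ / 12) ((℘'[L] Ω - W.a₁ * (℘[L] Ω - W.b₂ / 12) - W.a₃) / 2)).subst
        W.formalExp + C (W.b₂ / 12)) Q =
      Polynomial.aeval ((W.translateX (℘[L] Ω - W.b₂ / 12) ((℘'[L] Ω - W.a₁ * (℘[L] Ω - W.b₂ / 12) - W.a₃) / 2)).subst
        W.formalExp + C (W.b₂ / 12)) P := by
  -- the two translate series as Taylor series
  have hT := taylor_weierstrassP_add_sub_eq_translateX_subst_formalExp L W h₂ h₃ hΩ
  have hT₁ := taylor_weierstrassP_add_sub_eq_translateX_subst_formalExp L W h₂ h₃ hαΩ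
  -- `𝓣[v ↦ ℘(Ω + v)] = T + C b`
  have h℘ : AnalyticAt ℂ (fun v : ℂ => ℘[L] (Ω + v)) 0 := analyticAt_weierstrassP_const_add L hΩ
  have hTb : 𝓣[fun v : ℂ => ℘[L] (Ω + v)] =
      (W.translateX (℘[L] Ω - W.b₂ / 12) ((℘'[L] Ω - W.a₁ * (℘[L] Ω - W.b₂ / 12) - W.a₃) / 2)).subst W.formalExp +
        C (W.b₂ / 12) := by
    have e : (fun v : ℂ => ℘[L] (Ω + v)) = (fun v : ℂ => ℘[L] (Ω + v) - W.b₂ / 12) + fun _ => W.b₂ / 12 := by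
      funext v; simp
    have ha : AnalyticAt ℂ (fun v : ℂ => ℘[L] (Ω + v) - W.b₂ / 12) 0 := h℘.sub analyticAt_const
    rw [e, taylor_add ha analyticAt_const, hT, taylor_const]
  -- `𝓣[v ↦ ℘(αΩ + αv) − b] = rescale α T₁`
  have hF : 𝓣[fun v : ℂ => ℘[L] (α * Ω + α * v) - W.b₂ / 12] =
      rescale α ((W.translateX (℘[L] (α * Ω) - W.b₂ / 12)
        ((℘'[L] (α * Ω) - W.a₁ * (℘[L] (α * Ω) - W.b₂ / 12) - W.a₃) / 2)).subst W.formalExp) := by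
    rw [← hT₁]
    exact taylor_comp_const_mul (fun u : ℂ => ℘[L] (α * Ω + u) - W.b₂ / 12) α
  -- the function identity near `0`: `(℘(αΩ + αv) − b + b) · Q(℘(Ω + v)) = P(℘(Ω + v))`
  have hev : (fun v : ℂ => (℘[L] (α * Ω + α * v) - W.b₂ / 12 + W.b₂ / 12) * Q.eval (℘[L] (Ω + v))) =ᶠ[𝓝 0]
      fun v : ℂ => P.eval (℘[L] (Ω + v)) := by
    filter_upwards [eventually_mul_add_notMem_lattice L hαΩ] with v hv
    obtain ⟨hQ, hPQ⟩ := hR (Ω + v) hv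
    rw [sub_add_cancel, ← mul_add, hPQ, div_mul_cancel₀ _ hQ]
  -- Taylor series of both sides
  have h℘α : AnalyticAt ℂ (fun v : ℂ => ℘[L] (α * Ω + α * v)) 0 :=
    (L.analyticOnNhd_weierstrassP (α * Ω) (by simpa using hαΩ)).comp_of_eq (by fun_prop) (by simp)
  have hA : AnalyticAt ℂ (fun v : ℂ => ℘[L] (α * Ω + α * v) - W.b₂ / 12 + W.b₂ / 12) 0 :=
    (h℘α.sub analyticAt_const).add analyticAt_const
  have hTA : 𝓣[fun v : ℂ => ℘[L] (α * Ω + α * v) - W.b₂ / 12 + W.b₂ / 12] =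
      rescale α ((W.translateX (℘[L] (α * Ω) - W.b₂ / 12)
        ((℘'[L] (α * Ω) - W.a₁ * (℘[L] (α * Ω) - W.b₂ / 12) - W.a₃) / 2)).subst W.formalExp) + C (W.b₂ / 12) := by
    have e : (fun v : ℂ => ℘[L] (α * Ω + α * v) - W.b₂ / 12 + W.b₂ / 12) =
        (fun v : ℂ => ℘[L] (α * Ω + α * v) - W.b₂ / 12) + fun _ => W.b₂ / 12 := by
      funext v; simp
    have ha : AnalyticAt ℂ (fun v : ℂ => ℘[L] (α * Ω + α * v) - W.b₂ / 12) 0 := h℘α.sub analyticAt_const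
    rw [e, taylor_add ha analyticAt_const, hF, taylor_const]
  have key := taylor_congr hev
  rw [show (fun v : ℂ => (℘[L] (α * Ω + α * v) - W.b₂ / 12 + W.b₂ / 12) * Q.eval (℘[L] (Ω + v))) =
      (fun v : ℂ => ℘[L] (α * Ω + α * v) - W.b₂ / 12 + W.b₂ / 12) * fun v : ℂ => Q.eval (℘[L] (Ω + v)) from rfl,
    taylor_mul hA (analyticAt_eval_comp h℘ Q), hTA, taylor_eval_comp h℘ Q, taylor_eval_comp h℘ P, hTb] at key
  exact key

/-! ## §3 Cancelling `exp_W`: the identity in the formal-group coordinate -/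

omit L in
/-- `rescale α exp_W = [α]_Ê ∘ exp_W` with `[α]_Ê = exp_W ∘ (α log_W)`: `exp(α log(exp z)) = exp(αz)`.
[cite: SilvermanAEC2009, IV.5] -/
theorem rescale_formalExp_eq_subst :
    ∀ α : ℂ, rescale α W.formalExp = PowerSeries.subst W.formalExp (PowerSeries.subst (C α * W.formalLog) W.formalExp) := by
  intro α
  have hexp : HasSubst W.formalExp := HasSubst.of_constantCoeff_zero' W.constantCoeff_formalExp
  have hlog : HasSubst (C α * W.formalLog) := HasSubst.of_constantCoeff_zero' (by
    change PowerSeries.constantCoeff (C α * W.formalLog) = 0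
    rw [map_mul, W.constantCoeff_formalLog, mul_zero])
  rw [subst_comp_subst_apply hlog hexp, rescale_eq_subst]
  congr 1
  rw [← coe_substAlgHom hexp, map_mul, substAlgHom_C, coe_substAlgHom, W.formalLog_subst_formalExp, smul_eq_C_mul]

omit L in
/-- Substitution of `exp_W` after a constant-term-free `g`: `(f ∘ g) ∘ exp = f ∘ (g ∘ exp)`. [cite: SilvermanAEC2009, IV.1] -/
private theorem subst_subst_formalExp (f g : PowerSeries ℂ) (hg : constantCoeff g = 0) :
    PowerSeries.subst W.formalExp (PowerSeries.subst g f) = PowerSeries.subst (PowerSeries.subst W.formalExp g) f :=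
  subst_comp_subst_apply (HasSubst.of_constantCoeff_zero' hg) (HasSubst.of_constantCoeff_zero' W.constantCoeff_formalExp) f

omit L in
/-- `∘ exp_W` is injective: `f ∘ exp_W = g ∘ exp_W → f = g` (compose with `log_W`). [cite: SilvermanAEC2009, IV.5] -/
theorem subst_formalExp_injective {f g : PowerSeries ℂ} (h : f.subst W.formalExp = g.subst W.formalExp) : f = g := by
  have hexp : HasSubst W.formalExp := HasSubst.of_constantCoeff_zero' W.constantCoeff_formalExp
  have hlog : HasSubst W.formalLog := HasSubst.of_constantCoeff_zero' W.constantCoeff_formalLog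
  have h' := congrArg (PowerSeries.subst W.formalLog) h
  rw [subst_comp_subst_apply hexp hlog, subst_comp_subst_apply hexp hlog, W.formalExp_subst_formalLog, X_subst, X_subst] at h'
  exact h'

/-- ★★★ **The CM transformation identity in the formal-group coordinate** (cancel `exp_W` in §2): with `[α]_Ê := exp_W ∘ (α·log_W)`
(`W.formalExp.subst (C α * W.formalLog)`),
**`((translateX(ξ(αΩ))) ∘ [α]_Ê + C b) · Q(translateX(ξ Ω) + C b) = P(translateX(ξ Ω) + C b)`** in `ℂ⟦t⟧` — i.e.
`x(ξ(αΩ) ⊕ P([α]_Ê t)) = R(x(ξ Ω ⊕ P(t)))` as `t`-series: on the translate of the formal group through `P₁ = ξ(Ω)` the `x`-coordinate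
of the algebraic multiplication `[α]` (chart `R = P/Q` in the `℘`-coordinate) is computed by the formal endomorphism `[α]_Ê`.
[cite: deShalit1987, II §1.10, §4.9] [cite: SilvermanATAEC1994, II Prop. 1.1] [cite: Cox2013, Prop. 14.9] -/
theorem translateX_subst_formalMulBy_add_C_mul_aeval_eq (h₂ : L.g₂ = W.c₄ / 12) (h₃ : L.g₃ = W.c₆ / 216) {α : ℂ}
    {P Q : Polynomial ℂ}
    (hR : ∀ z : ℂ, α * z ∉ L.lattice → Q.eval (℘[L] z) ≠ 0 ∧ ℘[L] (α * z) = P.eval (℘[L] z) / Q.eval (℘[L] z))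
    {Ω : ℂ} (hΩ : Ω ∉ L.lattice) (hαΩ : α * Ω ∉ L.lattice) :
    ((W.translateX (℘[L] (α * Ω) - W.b₂ / 12) ((℘'[L] (α * Ω) - W.a₁ * (℘[L] (α * Ω) - W.b₂ / 12) - W.a₃) / 2)).subst
        (PowerSeries.subst (C α * W.formalLog) W.formalExp) + C (W.b₂ / 12)) *
      Polynomial.aeval (W.translateX (℘[L] Ω - W.b₂ / 12) ((℘'[L] Ω - W.a₁ * (℘[L] Ω - W.b₂ / 12) - W.a₃) / 2) + C (W.b₂ / 12)) Q =
      Polynomial.aeval (W.translateX (℘[L] Ω - W.b₂ / 12) ((℘'[L] Ω - W.a₁ * (℘[L] Ω - W.b₂ / 12) - W.a₃) / 2) + C (W.b₂ / 12)) P := by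
  have hexp : HasSubst W.formalExp := HasSubst.of_constantCoeff_zero' W.constantCoeff_formalExp
  have hmul0 : constantCoeff (W.formalExp.subst (C α * W.formalLog)) = 0 :=
    constantCoeff_subst_eq_zero (a := C α * W.formalLog) (by
      change PowerSeries.constantCoeff (C α * W.formalLog) = 0
      rw [map_mul, W.constantCoeff_formalLog, mul_zero]) _ W.constantCoeff_formalExp
  apply subst_formalExp_injective W
  have key := rescale_translateX_subst_formalExp_mul_aeval_eq L W h₂ h₃ hR hΩ hαΩ
  -- push `∘ exp_W` through the ring operations and `aeval`
  rw [← coe_substAlgHom hexp, map_mul, map_add, substAlgHom_C, ← Polynomial.aeval_algHom_apply,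
    ← Polynomial.aeval_algHom_apply, map_add, substAlgHom_C, coe_substAlgHom,
    subst_subst_formalExp W _ _ hmul0, ← rescale_formalExp_eq_subst W α]
  -- `translateX₁ ∘ (rescale α exp) = rescale α (translateX₁ ∘ exp)`
  rw [rescale_eq_subst]
  rw [rescale_eq_subst, subst_comp_subst_apply hexp (HasSubst.smul_X' α)] at key
  exact key

end WeierstrassCurve

end
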